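import Literature.NumberTheory.EllipticCurves.CMFormalActionLaneCoherence
import Literature.NumberTheory.EllipticCurves.DivisionPointsOnLaneCurve
import Literature.NumberTheory.EllipticCurves.CMChartIdentitiesOfTransformation
import Literature.NumberTheory.EllipticCurves.CMChartIdentitiesModel
import Literature.NumberTheory.EllipticCurves.FormalGroupLubinTateDivisionPointsOrdinaryRoot
import Literature.NumberTheory.EllipticCurves.X049IntegralModelReadings
import Mathlib.Algebra.Polynomial.Eval.Degree
import HarnessLib

/-!
# The `[π]`-coherence (N3) of de Shalit's division points on the lane curve, from READINGS: `[π]_{P′} z(U_{m+1}) = ι z(U_m)`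
# (de Shalit II.4.4 (iv) / II.4.9 (ii) assembled levelwise — proofs only)

Topic `NumberTheory/EllipticCurves` (theorems only; no definition, no named fact, no instance).  Cell `bsd-print-cf2`, width seat
`bsd-line-cf2c-w4` g15, brick B10f-a of the memo `ALPHA-ASSEMBLY-w4g15.md`.  The lane: `F` local with `e : 𝒪_F ≃ ℤ_p`, an INTEGER model
`W/ℤ` whose `ℤ_p`-copy `V = W ⊗ ℤ_p` is ordinary (`V̂ = F_P`, `p = ϖπ`), levels `M ≤ M⁺` (finite over `F`, inside `F̄`); the global side: a
field `K♭` read in `ℂ` by `ι_ℂ` and in `F̄` by `ι_v`, a lattice `Λ` with `g₂ = c₄(W)/12`, `g₃ = c₆(W)/216`, the points `ξ(z) = (℘ z − b₂/12, …)`;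
the theta presentation: a ring `R` with `ψ : R → 𝒪_{M⁺}` and `j : R → K♭` reading alike (`ψ r = ι_v (j r)` in `F̄`), the formal CM action
`T_R` (`T_R ⊗_ψ 𝒪 = P′ ⊗ 𝒪`), the base points `(x₀, y₀) = ξ(Ω₁)`, `(x₁, y₁) = ξ(αΩ₁)` over `R`, the re-centred transformation polynomials
`P̂_R, Q̂_R` (`Q̂ = s·Q(X + b)`, `P̂ = s·(P(X + b) − b·Q(X + b))` read in `ℂ`, `P(℘ z) = ℘(αz)·Q(℘ z)`), and the series identities `hidX`/`hidY`
over `R` (`DeShalit1987/CMFormalActionReadingIdentities`).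

* §0 `cmChart_recenter` — the chart identities with shift `b` for `(P, Q)` give those with shift `0` for `(P̂, Q̂)` (linear algebra);
* §1 `coe_ltSMul_zPt_ne_zero_of_addOrderOf` — `[π]_{P′} z(U) ≠ 0` for `U ∈ E₁` of order `p^{n+2}`; `some_inclusion_mem_kernel`;
* §2 `cmChart_of_readings` — the two chart identities IN `M⁺` for the readings of `Z = ξ(α(Ω₁ + u⁺))` and `(X₀, Y₀) = ξ(Ω₁ + u⁺)`
  (ℂ: `PeriodPair.cmChart_of_transformation` + §0; then `K♭` and `M⁺` by `cmChart_of_map_injective` / `cmChart_map`); `eval₂_ne_zero_of_readings`;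
* §3 ★★★ `ltSMul_zPt_eq_inclPt_zPt_of_readings` — **`[π]_{P′} z(U⁺) = ι z(U)`** for `U = ξ(u)` read in `M`, `U⁺ = ξ(u⁺)` read in `M⁺`,
  `αu⁺ ≡ u (mod Λ)`, both in the kernel of reduction, `U⁺` of order `p^{n+2}`: `CMFormalActionLaneCoherence.ptOfZ_ltSMul_eq_sub_of_cm_identities`
  (P(`[π] z(U⁺)`) `= ξ(α(Ω₁+u⁺)) − ξ(αΩ₁)`), `DivisionPointsOnLaneCurve.some_sub_some_eq_some_curveOver_of_readings` (`= ξ(αu⁺) = ξ(u)` read in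
  `M⁺`), `eq_zPt_of_ptOfZ_eq`, `zPt_some_eq_inclPt_zPt_some` — the hypothesis (hcoh) of
  `DeShalitThetaTExpansionColemanBridge.exists_unit_relColemanSeries_eq_subst_subst_of_divisionPoints` at one level.

No summit statement is proved; BSD is not proved by any of this.

## References
* [deShalit1987] E. de Shalit, *Iwasawa theory of elliptic curves with complex multiplication* (1987), II §1.10, II §4.4 (iv), II §4.9 (ii).
* [SilvermanAEC2009] J. H. Silverman, *The Arithmetic of Elliptic Curves*, 2nd ed. (2009), III.2.3, VI.3.6 (b), VII.2.2.
* [Cox2013] D. A. Cox, *Primes of the form x² + ny²*, 2nd ed. (2013), Prop. 14.9.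
-/

noncomputable section

open scoped Classical PeriodPair
open Polynomial

namespace Literature.NumberTheory.EllipticCurves

open ValuativeRel Literature.NumberTheory.GaloisRepresentations
  Literature.NumberTheory.GaloisRepresentations.IsNonarchimedeanLocalField
  Literature.NumberTheory.GaloisRepresentations.LubinTate Field
open Literature.NumberTheory.EllipticCurves.FormalGroupChart _root_.WeierstrassCurve _root_.PeriodPair

/-! ## §0 Re-centring the shift `b ↦ 0` at the level of the chart identities -/

section Recenter

variable {A : Type*} [CommRing A] {F : Type*} [Field F] (φ : A →+* F)

/-- **Re-centring `b ↦ 0`**: if the chart identities hold for `(P, Q)` with the shift `b`, they hold with the shift `0` for the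
re-centred pair `Q̂ = s·Q(X + b)`, `P̂ = s·(P(X + b) − b·Q(X + b))` (any scalar `s`; both identities are linear in `(P, Q)`) — the
point-level companion of `CMFormalActionReadingIdentities.cmX_identity_recenter` / `cmY_identity_recenter`, matching the `b := 0` shapes of
`CMFormalActionNilIdealPointsChart.some_add_ptOfZ_evalPt₁_eq_of_cm_identities`. [cite: deShalit1987, II §4.9 (ii)] [cite: Cox2013, Prop. 14.9] -/
theorem cmChart_recenter {P Q : A[X]} {α b a₁ a₃ : A} (s : A) {X₀ Y₀ xZ yZ : F}
    (hX : (xZ + φ b) * Q.eval₂ φ (X₀ + φ b) = P.eval₂ φ (X₀ + φ b))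
    (hY : φ α * (2 * yZ + φ a₁ * xZ + φ a₃) * Q.eval₂ φ (X₀ + φ b) +
          (xZ + φ b) * (derivative Q).eval₂ φ (X₀ + φ b) * (2 * Y₀ + φ a₁ * X₀ + φ a₃) =
        (derivative P).eval₂ φ (X₀ + φ b) * (2 * Y₀ + φ a₁ * X₀ + φ a₃)) :
    (xZ + φ 0) * (C s * Q.comp (X + C b)).eval₂ φ (X₀ + φ 0) =
        (C s * (P.comp (X + C b) - C b * Q.comp (X + C b))).eval₂ φ (X₀ + φ 0) ∧
      φ α * (2 * yZ + φ a₁ * xZ + φ a₃) * (C s * Q.comp (X + C b)).eval₂ φ (X₀ + φ 0) +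
          (xZ + φ 0) * (derivative (C s * Q.comp (X + C b))).eval₂ φ (X₀ + φ 0) * (2 * Y₀ + φ a₁ * X₀ + φ a₃) =
        (derivative (C s * (P.comp (X + C b) - C b * Q.comp (X + C b)))).eval₂ φ (X₀ + φ 0) *
          (2 * Y₀ + φ a₁ * X₀ + φ a₃) := by
  have hq : ∀ R : A[X], (R.comp (X + C b)).eval₂ φ X₀ = R.eval₂ φ (X₀ + φ b) := fun R => by
    rw [eval₂_comp, eval₂_add, eval₂_X, eval₂_C]
  have hq' : ∀ R : A[X], (derivative (R.comp (X + C b))).eval₂ φ X₀ = (derivative R).eval₂ φ (X₀ + φ b) := fun R => by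
    rw [derivative_comp, derivative_add, derivative_X, derivative_C, add_zero, one_mul, hq]
  simp only [map_zero, add_zero]
  simp only [derivative_mul, derivative_sub, derivative_C, zero_mul, zero_add, eval₂_mul, eval₂_sub, eval₂_C, hq, hq']
  constructor
  · linear_combination φ s * hX
  · linear_combination φ s * hY

end Recenter

/-! ## §1 Lane lemmas: `[π] z(U) ≠ 0` from the order; the inclusion of a kernel point is a kernel point -/

section Lane

variable {F : Type} [Field F] [ValuativeRel F] [TopologicalSpace F] [IsNonarchimedeanLocalField F]

attribute [local instance] ltNormUniformSpace ltNormIsUniformAddGroup rk1 nF nE fintypeResidueField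

variable {p : ℕ} [Fact p.Prime] (e : 𝒪[F] ≃+* ℤ_[p]) (hq : residueFieldCard F = p)
  {π : 𝒪[F]} (hπ : (valuation F).IsUniformizer (π : F)) {πZ : ℤ_[p]} (he : e π = πZ)
  (hA : IsLTRing πZ p) {P : PowerSeries ℤ_[p]} (hP : IsLTSeries πZ p P)
  {V : WeierstrassCurve ℤ_[p]} (hV : V.formalGroupLaw = ltF hA hP) {ϖ : ℤ_[p]} (hp : (p : ℤ_[p]) = ϖ * πZ) (hϖ : IsUnit ϖ)
  (M : IntermediateField F (AlgebraicClosure F)) [FiniteDimensional F M]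
  [hEll : (curveOver M (V.map ((LTCoeff.of F).toRingHom.comp e.symm.toRingHom))).IsElliptic]

include hq he hV hp hϖ in
/-- **`[π]_{P′} z(U) ≠ 0` for `U ∈ E₁(M)` of order `p^{n+2}`** (else `[π^{n+1}] z(U) = 0`, contradicting
`ltSMul_pow_hom_one_zPt_of_addOrderOf`) — the hypothesis `hs0` of `ptOfZ_ltSMul_eq_sub_of_cm_identities` for de Shalit's `U_{m+1}`.
[cite: deShalit1987, II §4.4 (iv)] [cite: SilvermanAEC2009, VII.2.2] -/
theorem coe_ltSMul_zPt_ne_zero_of_addOrderOf {n : ℕ}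
    {U : (curveOver M (V.map ((LTCoeff.of F).toRingHom.comp e.symm.toRingHom))).toAffine.Point}
    (hU : U ∈ kernel (NormedField.valuation (K := M)) (curveOver M (V.map ((LTCoeff.of F).toRingHom.comp e.symm.toRingHom))))
    (hord : addOrderOf U = p ^ (n + 2)) :
    (((ltSMul (maxNilIdeal F M) (isLTRing_LTCoeff hπ) (isLTSeries_map_LTCoeff_of_degree_one e hq he hP) (LTCoeff.of F π)
        (zPt U hU) : (maxNilIdeal F M).toIdeal) : unitBall M) : M) ≠ 0 := by
  have h := ltSMul_pow_hom_one_zPt_of_addOrderOf (K := M) (isLTRing_LTCoeff hπ) (isLTSeries_map_LTCoeff_of_degree_one e hq he hP)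
    (isLTSeries_map_LTCoeff_of_degree_one e hq he hP) (formalGroupLaw_map_eq_ltF_of_degree_one e hq hπ he hA hP V hV)
    (natCast_eq_mul_of_degree_one e he hp) (isUnit_map_of_degree_one e hϖ) hU hord
  intro h0
  apply h.2
  have hz : ltSMul (maxNilIdeal F M) (isLTRing_LTCoeff hπ) (isLTSeries_map_LTCoeff_of_degree_one e hq he hP) (LTCoeff.of F π)
      (zPt U hU) = 0 := Subtype.ext (Subtype.ext h0)
  rw [ltSMul_evalPt₁_hom_one_eq_zero_iff, pow_succ, mul_ltSMul]
  change ltSMul (maxNilIdeal F M) (isLTRing_LTCoeff hπ) (isLTSeries_map_LTCoeff_of_degree_one e hq he hP) (LTCoeff.of F π ^ n)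
    (ltSMul (maxNilIdeal F M) (isLTRing_LTCoeff hπ) (isLTSeries_map_LTCoeff_of_degree_one e hq he hP) (LTCoeff.of F π) (zPt U hU)) = 0
  rw [hz, ltSMul_zero]

omit hEll in
/-- **A kernel point read one level up is a kernel point** (`‖ι x‖ = ‖x‖`). [cite: SilvermanAEC2009, VII.2.2] -/
theorem some_inclusion_mem_kernel {M' : IntermediateField F (AlgebraicClosure F)} [FiniteDimensional F M'] (hle : M ≤ M')
    (Vc : WeierstrassCurve (LTCoeff F)) [(curveOver M Vc).IsElliptic] [(curveOver M' Vc).IsElliptic] {X Y : M}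
    {h : (curveOver M Vc).toAffine.Nonsingular X Y}
    (hU : (.some X Y h : (curveOver M Vc).toAffine.Point) ∈ kernel (NormedField.valuation (K := M)) (curveOver M Vc))
    {h' : (curveOver M' Vc).toAffine.Nonsingular (IntermediateField.inclusion hle X) (IntermediateField.inclusion hle Y)} :
    (.some _ _ h' : (curveOver M' Vc).toAffine.Point) ∈ kernel (NormedField.valuation (K := M')) (curveOver M' Vc) := by
  rw [some_mem_kernel_iff] at hU ⊢
  rw [← NNReal.coe_lt_coe, NormedField.valuation_apply, coe_nnnorm, NNReal.coe_one] at hU ⊢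
  rwa [norm_inclusion]

end Lane

/-! ## §2 The chart identities in `M′` from readings -/

section Readings

variable {F : Type} [Field F] [ValuativeRel F] [TopologicalSpace F] [IsNonarchimedeanLocalField F]

attribute [local instance] ltNormUniformSpace ltNormIsUniformAddGroup rk1 nF nE fintypeResidueField

variable (M' : IntermediateField F (AlgebraicClosure F)) [FiniteDimensional F M']
  {Kb : Type*} [Field Kb] (ιc : Kb →+* ℂ) (ιv : Kb →+* AlgebraicClosure F)
  {R : Type*} [CommRing R] (ψ : R →+* unitBall M') (j : R →+* Kb)
  (hψj : ∀ r : R, ((((ψ r : unitBall M') : M') : AlgebraicClosure F)) = ιv (j r))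
  (W : WeierstrassCurve ℤ) (L : PeriodPair)

include hψj in
/-- `(𝒪_{M′} ⊂ M′ ⊂ F̄) ∘ ψ = ι_v ∘ j` as ring maps. [cite: deShalit1987, II §4.9 (ii)] -/
theorem algebraMap_comp_subtype_comp_eq :
    (algebraMap M' (AlgebraicClosure F)).comp ((unitBall M').subtype.comp ψ) = ιv.comp j :=
  RingHom.ext fun r => hψj r

include hψj in
/-- **`Q̂_R(X_W) ≠ 0` in `M′`** when `s ≠ 0` and `Q(℘ w) ≠ 0` (`Q̂ = s·Q(X + b)` read in `ℂ`, `X_W` reading `℘ w − b`).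
[cite: deShalit1987, II §4.9 (ii)] [cite: Cox2013, Prop. 14.9] -/
theorem eval₂_ne_zero_of_readings {QC : ℂ[X]} {Qr : R[X]} {s : ℂ} (hs : s ≠ 0)
    (hQr : Qr.map (ιc.comp j) = C s * QC.comp (X + C ((W.baseChange ℂ).b₂ / 12)))
    {w : ℂ} (hQ : QC.eval (℘[L] w) ≠ 0) {xw : Kb} (hxw : ιc xw = ℘[L] w - (W.baseChange ℂ).b₂ / 12)
    {XW : M'} (hXW : ((XW : M') : AlgebraicClosure F) = ιv xw) :
    Qr.eval₂ ((unitBall M').subtype.comp ψ) (XW + ((ψ 0 : unitBall M') : M')) ≠ 0 := by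
  intro h0
  simp only [map_zero, ZeroMemClass.coe_zero, add_zero] at h0
  have h1 := congrArg (algebraMap M' (AlgebraicClosure F)) h0
  rw [hom_eval₂, algebraMap_comp_subtype_comp_eq M' ιv ψ j hψj, map_zero,
    show algebraMap M' (AlgebraicClosure F) XW = ιv xw from hXW, ← hom_eval₂, map_eq_zero_iff ιv ιv.injective] at h1
  have h3 := congrArg ιc h1
  rw [hom_eval₂, ← eval_map, hQr, map_zero, hxw, eval_mul, eval_C, eval_comp, eval_add, eval_X, eval_C, sub_add_cancel] at h3
  exact mul_ne_zero hs hQ h3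

include hψj in
/-- ★★ **The chart identities in `M′` from readings.**  For the transformation pair `P(℘ z) = ℘(αz)·Q(℘ z)` (`α = ι_ℂ j α_R`), the
re-centred lifts `Q̂_R, P̂_R` over `R`, and `M′`-elements `X_W, Y_W, X_Z, Y_Z` reading (through `K♭`) the model coordinates of `ξ(w)` and
`ξ(αw)` (`w, αw ∉ Λ`): the `x`- and `y`-shape identities of `CMFormalActionNilIdealPointsChart` hold in `M′` with `b := 0` for
`W_R = W ⊗ R`, `P̂_R`, `Q̂_R`, `α_R` — over `ℂ` by `PeriodPair.cmChart_of_transformation` and `cmChart_recenter`, then reflected into `K♭`,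
pushed to `F̄` and reflected into `M′` (`cmChart_of_map_injective`, `cmChart_map`). [cite: deShalit1987, II §1.10, II §4.9 (ii)] [cite: Cox2013, Prop. 14.9] -/
theorem cmChart_of_readings {αR : R} {PC QC : ℂ[X]}
    (hT : ∀ z : ℂ, z ∉ L.lattice → ιc (j αR) * z ∉ L.lattice → PC.eval (℘[L] z) = ℘[L] (ιc (j αR) * z) * QC.eval (℘[L] z))
    {Pr Qr : R[X]} {s : ℂ}
    (hQr : Qr.map (ιc.comp j) = C s * QC.comp (X + C ((W.baseChange ℂ).b₂ / 12)))
    (hPr : Pr.map (ιc.comp j) = C s * (PC.comp (X + C ((W.baseChange ℂ).b₂ / 12)) -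
      C ((W.baseChange ℂ).b₂ / 12) * QC.comp (X + C ((W.baseChange ℂ).b₂ / 12))))
    {w : ℂ} (hw : w ∉ L.lattice) (hαw : ιc (j αR) * w ∉ L.lattice)
    {xw yw xz yz : Kb} (hxw : ιc xw = ℘[L] w - (W.baseChange ℂ).b₂ / 12)
    (hyw : ιc yw = (℘'[L] w - (W.baseChange ℂ).a₁ * (℘[L] w - (W.baseChange ℂ).b₂ / 12) - (W.baseChange ℂ).a₃) / 2)
    (hxz : ιc xz = ℘[L] (ιc (j αR) * w) - (W.baseChange ℂ).b₂ / 12)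
    (hyz : ιc yz = (℘'[L] (ιc (j αR) * w) - (W.baseChange ℂ).a₁ * (℘[L] (ιc (j αR) * w) - (W.baseChange ℂ).b₂ / 12) -
      (W.baseChange ℂ).a₃) / 2)
    {XW YW XZ YZ : M'} (hXW : ((XW : M') : AlgebraicClosure F) = ιv xw) (hYW : ((YW : M') : AlgebraicClosure F) = ιv yw)
    (hXZ : ((XZ : M') : AlgebraicClosure F) = ιv xz) (hYZ : ((YZ : M') : AlgebraicClosure F) = ιv yz) :
    (XZ + ((ψ 0 : unitBall M') : M')) * Qr.eval₂ ((unitBall M').subtype.comp ψ) (XW + ((ψ 0 : unitBall M') : M')) =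
        Pr.eval₂ ((unitBall M').subtype.comp ψ) (XW + ((ψ 0 : unitBall M') : M')) ∧
      ((ψ αR : unitBall M') : M') * (2 * YZ + ((ψ (W.map (Int.castRingHom R)).a₁ : unitBall M') : M') * XZ +
            ((ψ (W.map (Int.castRingHom R)).a₃ : unitBall M') : M')) *
          Qr.eval₂ ((unitBall M').subtype.comp ψ) (XW + ((ψ 0 : unitBall M') : M')) +
        (XZ + ((ψ 0 : unitBall M') : M')) * (derivative Qr).eval₂ ((unitBall M').subtype.comp ψ) (XW + ((ψ 0 : unitBall M') : M')) *
          (2 * YW + ((ψ (W.map (Int.castRingHom R)).a₁ : unitBall M') : M') * XW + ((ψ (W.map (Int.castRingHom R)).a₃ : unitBall M') : M')) =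
      (derivative Pr).eval₂ ((unitBall M').subtype.comp ψ) (XW + ((ψ 0 : unitBall M') : M')) *
        (2 * YW + ((ψ (W.map (Int.castRingHom R)).a₁ : unitBall M') : M') * XW + ((ψ (W.map (Int.castRingHom R)).a₃ : unitBall M') : M')) := by
  -- (1) over `ℂ`, with the shift `b = b₂/12`, then re-centred
  obtain ⟨hXc, hYc⟩ := L.cmChart_of_transformation hT hw hαw (RingHom.id ℂ) (PA := PC) (QA := QC) (αA := ιc (j αR))
    (b := (W.baseChange ℂ).b₂ / 12) (a₁ := (W.baseChange ℂ).a₁) (a₃ := (W.baseChange ℂ).a₃) (Polynomial.map_id) (Polynomial.map_id) rfl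
    (X₀ := ιc xw) (Y₀ := ιc yw) (xZ := ιc xz) (yZ := ιc yz)
    (by rw [hxw, RingHom.id_apply, sub_add_cancel]) (by rw [hyw, hxw, RingHom.id_apply, RingHom.id_apply]; ring)
    (by rw [hxz, RingHom.id_apply, sub_add_cancel]) (by rw [hyz, hxz, RingHom.id_apply, RingHom.id_apply]; ring)
  obtain ⟨hXc', hYc'⟩ := cmChart_recenter (RingHom.id ℂ) s hXc hYc
  rw [← hQr, ← hPr] at hXc' hYc'
  simp only [Polynomial.derivative_map, eval₂_map, RingHom.id_comp, map_zero, add_zero, RingHom.id_apply] at hXc' hYc'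
  -- (2) reflect into `K♭` along `ι_ℂ`
  have hcoef₁ : (ιc.comp j) (W.map (Int.castRingHom R)).a₁ = (W.baseChange ℂ).a₁ := by simp [WeierstrassCurve.baseChange]
  have hcoef₃ : (ιc.comp j) (W.map (Int.castRingHom R)).a₃ = (W.baseChange ℂ).a₃ := by simp [WeierstrassCurve.baseChange]
  obtain ⟨hXk, hYk⟩ := cmChart_of_map_injective j ιc ιc.injective (P := Pr) (Q := Qr) (α := αR) (b := (0 : R))
    (a₁ := (W.map (Int.castRingHom R)).a₁) (a₃ := (W.map (Int.castRingHom R)).a₃) (X₀ := xw) (Y₀ := yw) (xZ := xz) (yZ := yz)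
    (by simpa only [map_zero, add_zero] using hXc')
    (by simpa only [map_zero, add_zero, hcoef₁, hcoef₃, RingHom.comp_apply] using hYc')
  -- (3) push to `F̄`, reflect into `M′`
  obtain ⟨hXv, hYv⟩ := cmChart_map j ιv hXk hYk
  have hθ := algebraMap_comp_subtype_comp_eq M' ιv ψ j hψj
  have key := cmChart_of_map_injective ((unitBall M').subtype.comp ψ) (algebraMap M' (AlgebraicClosure F))
    (algebraMap M' (AlgebraicClosure F)).injective (P := Pr) (Q := Qr) (α := αR) (b := (0 : R))
    (a₁ := (W.map (Int.castRingHom R)).a₁) (a₃ := (W.map (Int.castRingHom R)).a₃) (X₀ := XW) (Y₀ := YW) (xZ := XZ) (yZ := YZ)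
    (by rw [hθ, show algebraMap M' (AlgebraicClosure F) XZ = ιv xz from hXZ, show algebraMap M' (AlgebraicClosure F) XW = ιv xw from hXW]
        exact hXv)
    (by rw [hθ, show algebraMap M' (AlgebraicClosure F) XZ = ιv xz from hXZ, show algebraMap M' (AlgebraicClosure F) XW = ιv xw from hXW,
          show algebraMap M' (AlgebraicClosure F) YZ = ιv yz from hYZ, show algebraMap M' (AlgebraicClosure F) YW = ιv yw from hYW]
        exact hYv)
  exact key

end Readings

/-! ## §3 The coherence `[π]_{P′} z(U⁺) = ι z(U)` at one level -/

section Coherence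

variable {F : Type} [Field F] [ValuativeRel F] [TopologicalSpace F] [IsNonarchimedeanLocalField F]

attribute [local instance] ltNormUniformSpace ltNormIsUniformAddGroup rk1 nF nE fintypeResidueField

variable {p : ℕ} [Fact p.Prime] (e : 𝒪[F] ≃+* ℤ_[p]) (hq : residueFieldCard F = p)
  {π : 𝒪[F]} (hπ : (valuation F).IsUniformizer (π : F)) {πZ : ℤ_[p]} (he : e π = πZ)
  (hA : IsLTRing πZ p) {P : PowerSeries ℤ_[p]} (hP : IsLTSeries πZ p P) (W : WeierstrassCurve ℤ)
  (hV : (W.map (Int.castRingHom ℤ_[p])).formalGroupLaw = ltF hA hP) {ϖ : ℤ_[p]} (hp : (p : ℤ_[p]) = ϖ * πZ) (hϖ : IsUnit ϖ)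
  (M M' : IntermediateField F (AlgebraicClosure F)) [FiniteDimensional F M] [FiniteDimensional F M'] (hle : M ≤ M')
  [hEll : (curveOver M ((W.map (Int.castRingHom ℤ_[p])).map ((LTCoeff.of F).toRingHom.comp e.symm.toRingHom))).IsElliptic]
  [hEll' : (curveOver M' ((W.map (Int.castRingHom ℤ_[p])).map ((LTCoeff.of F).toRingHom.comp e.symm.toRingHom))).IsElliptic]
  {Kb : Type*} [Field Kb] (ιc : Kb →+* ℂ) (ιv : Kb →+* AlgebraicClosure F)
  {R : Type*} [CommRing R] (ψ : R →+* unitBall M') (j : R →+* Kb)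
  (hψj : ∀ r : R, ((((ψ r : unitBall M') : M') : AlgebraicClosure F)) = ιv (j r))
  (L : PeriodPair) (h₂ : L.g₂ = (W.baseChange ℂ).c₄ / 12) (h₃ : L.g₃ = (W.baseChange ℂ).c₆ / 216)

include hq he hV hp hϖ hψj h₂ h₃ in
set_option maxHeartbeats 1600000 in
/-- ★★★ **`[π]_{P′} z(U⁺) = ι z(U)` from readings** (see the module docstring).  Data: the lane (`e, π, P, W`, `V̂ = F_P`, `p = ϖπ`),
levels `M ≤ M′`, readings `ι_ℂ, ι_v` of `K♭`, the theta presentation `ψ, j` (`ψ = ι_v ∘ j`), the formal CM action `T_R` with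
`T_R ⊗_ψ 𝒪 = P′ ⊗ 𝒪`, the base points `ξ(Ω₁)`, `ξ(αΩ₁)` over `R`, the transformation pair and its re-centred `R`-lifts, the series identities
`hidX`/`hidY` over `R`; the points: `U = ξ(u)` read in `M` (kernel), `U⁺ = ξ(u⁺)` read in `M′` (kernel, order `p^{n+2}`), `αu⁺ ≡ u (mod Λ)`,
`ξ(Ω₁ + u⁺)` and `ξ(α(Ω₁ + u⁺))` read in `M′`, `Q(℘(Ω₁ + u⁺)) ≠ 0`, `s ≠ 0`, `2 ≠ 0` in `M′`.  Conclusion: the hypothesis (hcoh) of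
`exists_unit_relColemanSeries_eq_subst_subst_of_divisionPoints` at this level. [cite: deShalit1987, II §4.4 (iv), II §4.9 Proposition (ii)]
[cite: SilvermanAEC2009, III.2.3, VII.2.2] -/
theorem ltSMul_zPt_eq_inclPt_zPt_of_readings
    -- the CM datum over `R` and its complex reading
    {αR : R} {PC QC : ℂ[X]}
    (hT : ∀ z : ℂ, z ∉ L.lattice → ιc (j αR) * z ∉ L.lattice → PC.eval (℘[L] z) = ℘[L] (ιc (j αR) * z) * QC.eval (℘[L] z))
    {Pr Qr : R[X]} {s : ℂ} (hs : s ≠ 0)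
    (hQr : Qr.map (ιc.comp j) = C s * QC.comp (X + C ((W.baseChange ℂ).b₂ / 12)))
    (hPr : Pr.map (ιc.comp j) = C s * (PC.comp (X + C ((W.baseChange ℂ).b₂ / 12)) -
      C ((W.baseChange ℂ).b₂ / 12) * QC.comp (X + C ((W.baseChange ℂ).b₂ / 12))))
    {T : PowerSeries R} (hT0 : PowerSeries.constantCoeff T = 0)
    (hTP : T.map ψ = (P.map ((LTCoeff.of F).toRingHom.comp e.symm.toRingHom)).map (algebraMap (LTCoeff F) (unitBall M')))
    {x₀ y₀ x₁ y₁ : R}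
    (hidX : (((W.map (Int.castRingHom R)).translateX x₁ y₁).subst T + PowerSeries.C (0 : R)) *
        Polynomial.aeval ((W.map (Int.castRingHom R)).translateX x₀ y₀ + PowerSeries.C (0 : R)) Qr =
      Polynomial.aeval ((W.map (Int.castRingHom R)).translateX x₀ y₀ + PowerSeries.C (0 : R)) Pr)
    (hidY : PowerSeries.C αR * (2 * PowerSeries.subst T ((W.map (Int.castRingHom R)).translateY x₁ y₁) +
            PowerSeries.C (W.map (Int.castRingHom R)).a₁ * PowerSeries.subst T ((W.map (Int.castRingHom R)).translateX x₁ y₁) +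
            PowerSeries.C (W.map (Int.castRingHom R)).a₃) *
          Polynomial.aeval ((W.map (Int.castRingHom R)).translateX x₀ y₀ + PowerSeries.C (0 : R)) Qr +
        (PowerSeries.subst T ((W.map (Int.castRingHom R)).translateX x₁ y₁) + PowerSeries.C (0 : R)) *
          Polynomial.aeval ((W.map (Int.castRingHom R)).translateX x₀ y₀ + PowerSeries.C (0 : R)) (Polynomial.derivative Qr) *
          (2 * (W.map (Int.castRingHom R)).translateY x₀ y₀ +
            PowerSeries.C (W.map (Int.castRingHom R)).a₁ * (W.map (Int.castRingHom R)).translateX x₀ y₀ +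
            PowerSeries.C (W.map (Int.castRingHom R)).a₃) =
      Polynomial.aeval ((W.map (Int.castRingHom R)).translateX x₀ y₀ + PowerSeries.C (0 : R)) (Polynomial.derivative Pr) *
        (2 * (W.map (Int.castRingHom R)).translateY x₀ y₀ +
          PowerSeries.C (W.map (Int.castRingHom R)).a₁ * (W.map (Int.castRingHom R)).translateX x₀ y₀ +
          PowerSeries.C (W.map (Int.castRingHom R)).a₃))
    -- the arguments and their readings
    {Ω₁ u u' : ℂ} (hΩ₁ : Ω₁ ∉ L.lattice) (hαΩ₁ : ιc (j αR) * Ω₁ ∉ L.lattice) (hu : u ∉ L.lattice) (hu' : u' ∉ L.lattice)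
    (hw : Ω₁ + u' ∉ L.lattice) (hαw : ιc (j αR) * (Ω₁ + u') ∉ L.lattice) (hαu : ιc (j αR) * u' - u ∈ L.lattice)
    (hQ : QC.eval (℘[L] (Ω₁ + u')) ≠ 0)
    (hx₀ : ιc (j x₀) = ℘[L] Ω₁ - (W.baseChange ℂ).b₂ / 12)
    (hy₀ : ιc (j y₀) = (℘'[L] Ω₁ - (W.baseChange ℂ).a₁ * (℘[L] Ω₁ - (W.baseChange ℂ).b₂ / 12) - (W.baseChange ℂ).a₃) / 2)
    (hx₁ : ιc (j x₁) = ℘[L] (ιc (j αR) * Ω₁) - (W.baseChange ℂ).b₂ / 12)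
    (hy₁ : ιc (j y₁) = (℘'[L] (ιc (j αR) * Ω₁) - (W.baseChange ℂ).a₁ * (℘[L] (ιc (j αR) * Ω₁) - (W.baseChange ℂ).b₂ / 12) -
      (W.baseChange ℂ).a₃) / 2)
    {xu yu xu' yu' xw yw xz yz : Kb}
    (hxu : ιc xu = ℘[L] u - (W.baseChange ℂ).b₂ / 12)
    (hyu : ιc yu = (℘'[L] u - (W.baseChange ℂ).a₁ * (℘[L] u - (W.baseChange ℂ).b₂ / 12) - (W.baseChange ℂ).a₃) / 2)
    (hxu' : ιc xu' = ℘[L] u' - (W.baseChange ℂ).b₂ / 12)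
    (hyu' : ιc yu' = (℘'[L] u' - (W.baseChange ℂ).a₁ * (℘[L] u' - (W.baseChange ℂ).b₂ / 12) - (W.baseChange ℂ).a₃) / 2)
    (hxw : ιc xw = ℘[L] (Ω₁ + u') - (W.baseChange ℂ).b₂ / 12)
    (hyw : ιc yw = (℘'[L] (Ω₁ + u') - (W.baseChange ℂ).a₁ * (℘[L] (Ω₁ + u') - (W.baseChange ℂ).b₂ / 12) - (W.baseChange ℂ).a₃) / 2)
    (hxz : ιc xz = ℘[L] (ιc (j αR) * (Ω₁ + u')) - (W.baseChange ℂ).b₂ / 12)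
    (hyz : ιc yz = (℘'[L] (ιc (j αR) * (Ω₁ + u')) - (W.baseChange ℂ).a₁ * (℘[L] (ιc (j αR) * (Ω₁ + u')) - (W.baseChange ℂ).b₂ / 12) -
      (W.baseChange ℂ).a₃) / 2)
    {XU YU : M} (hXU : ((XU : M) : AlgebraicClosure F) = ιv xu) (hYU : ((YU : M) : AlgebraicClosure F) = ιv yu)
    {XU' YU' XW YW XZ YZ : M'} (hXU' : ((XU' : M') : AlgebraicClosure F) = ιv xu') (hYU' : ((YU' : M') : AlgebraicClosure F) = ιv yu')
    (hXW : ((XW : M') : AlgebraicClosure F) = ιv xw) (hYW : ((YW : M') : AlgebraicClosure F) = ιv yw)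
    (hXZ : ((XZ : M') : AlgebraicClosure F) = ιv xz) (hYZ : ((YZ : M') : AlgebraicClosure F) = ιv yz)
    {hnU : (curveOver M ((W.map (Int.castRingHom ℤ_[p])).map ((LTCoeff.of F).toRingHom.comp e.symm.toRingHom))).toAffine.Nonsingular XU YU}
    {hnU' : (curveOver M' ((W.map (Int.castRingHom ℤ_[p])).map ((LTCoeff.of F).toRingHom.comp e.symm.toRingHom))).toAffine.Nonsingular XU' YU'}
    (hU : (.some XU YU hnU : (curveOver M ((W.map (Int.castRingHom ℤ_[p])).map
        ((LTCoeff.of F).toRingHom.comp e.symm.toRingHom))).toAffine.Point) ∈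
      kernel (NormedField.valuation (K := M)) (curveOver M ((W.map (Int.castRingHom ℤ_[p])).map ((LTCoeff.of F).toRingHom.comp e.symm.toRingHom))))
    (hU' : (.some XU' YU' hnU' : (curveOver M' ((W.map (Int.castRingHom ℤ_[p])).map
        ((LTCoeff.of F).toRingHom.comp e.symm.toRingHom))).toAffine.Point) ∈
      kernel (NormedField.valuation (K := M')) (curveOver M' ((W.map (Int.castRingHom ℤ_[p])).map ((LTCoeff.of F).toRingHom.comp e.symm.toRingHom))))
    {n : ℕ} (hord' : addOrderOf (.some XU' YU' hnU' : (curveOver M' ((W.map (Int.castRingHom ℤ_[p])).map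
        ((LTCoeff.of F).toRingHom.comp e.symm.toRingHom))).toAffine.Point) = p ^ (n + 2))
    (h2 : (2 : M') ≠ 0) :
    ltSMul (maxNilIdeal F M') (isLTRing_LTCoeff hπ) (isLTSeries_map_LTCoeff_of_degree_one e hq he hP) (LTCoeff.of F π)
        (zPt (.some XU' YU' hnU') hU') =
      inclPt hle (zPt (.some XU YU hnU) hU) := by
  -- the two presentations share one integral model
  have hWR : (W.map (Int.castRingHom R)).map ψ =
      ((W.map (Int.castRingHom ℤ_[p])).map ((LTCoeff.of F).toRingHom.comp e.symm.toRingHom)).map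
        (algebraMap (LTCoeff F) (unitBall M')) := by
    rw [WeierstrassCurve.map_map (W.map (Int.castRingHom ℤ_[p]))]
    exact WeierstrassCurve.map_intCast_eq_map_intCast W _ _
  have hα0 : ιc (j αR) ≠ 0 := fun h => hαΩ₁ (by rw [h, zero_mul]; exact zero_mem _)
  -- nonsingularity of the points involved
  have h₀ := nonsingular_curveOver_of_readings e M' W ιc ιv L h₂ h₃ hΩ₁ hx₀ hy₀ (X := ((ψ x₀ : unitBall M') : M'))
    (Y := ((ψ y₀ : unitBall M') : M')) (hψj x₀) (hψj y₀)
  have h₁ := nonsingular_curveOver_of_readings e M' W ιc ιv L h₂ h₃ hαΩ₁ hx₁ hy₁ (X := ((ψ x₁ : unitBall M') : M'))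
    (Y := ((ψ y₁ : unitBall M') : M')) (hψj x₁) (hψj y₁)
  have hnW := nonsingular_curveOver_of_readings e M' W ιc ιv L h₂ h₃ hw hxw hyw hXW hYW
  have hnZ := nonsingular_curveOver_of_readings e M' W ιc ιv L h₂ h₃ hαw hxz hyz hXZ hYZ
  -- `P₁ + U⁺ = ξ(Ω₁ + u⁺)` read in `M′`
  have hsub : (.some XW YW hnW : (curveOver M' ((W.map (Int.castRingHom ℤ_[p])).map
      ((LTCoeff.of F).toRingHom.comp e.symm.toRingHom))).toAffine.Point) - .some XU' YU' hnU' = .some _ _ h₀ :=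
    some_sub_some_eq_some_curveOver_of_readings e M' W ιc ιv L h₂ h₃ hΩ₁ hu' hw rfl hx₀ hy₀ hxu' hyu' hxw hyw (hψj x₀) (hψj y₀)
      hXU' hYU' hXW hYW h₀ hnU' hnW
  have hsum : (.some _ _ h₀ : (curveOver M' ((W.map (Int.castRingHom ℤ_[p])).map
      ((LTCoeff.of F).toRingHom.comp e.symm.toRingHom))).toAffine.Point) + .some XU' YU' hnU' = .some XW YW hnW :=
    (sub_eq_iff_eq_add.mp hsub).symm
  -- the chart identities, `Q̂(X_W) ≠ 0`, `α ≠ 0`, `[π] z(U⁺) ≠ 0`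
  obtain ⟨hZx, hZy⟩ := cmChart_of_readings M' ιc ιv ψ j hψj W L hT hQr hPr hw hαw hxw hyw hxz hyz hXW hYW hXZ hYZ
  have hQM := eval₂_ne_zero_of_readings M' ιc ιv ψ j hψj W L hs hQr hQ hxw hXW
  have hα : ((ψ αR : unitBall M') : M') ≠ 0 := by
    intro h0
    have h1 := congrArg (algebraMap M' (AlgebraicClosure F)) h0
    rw [map_zero, show algebraMap M' (AlgebraicClosure F) ((ψ αR : unitBall M') : M') = ιv (j αR) from hψj αR,
      map_eq_zero_iff ιv ιv.injective] at h1
    exact hα0 (by rw [h1, map_zero])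
  have hs0 := coe_ltSMul_zPt_ne_zero_of_addOrderOf e hq hπ he hA hP hV hp hϖ M' hU' hord'
  -- (CM-POINTS)(ii) on the lane curve: `P([π] z(U⁺)) = ξ(α(Ω₁ + u⁺)) − ξ(αΩ₁)`
  have key := ptOfZ_ltSMul_eq_sub_of_cm_identities M' (isLTRing_LTCoeff hπ) (isLTSeries_map_LTCoeff_of_degree_one e hq he hP)
    ((W.map (Int.castRingHom ℤ_[p])).map ((LTCoeff.of F).toRingHom.comp e.symm.toRingHom)) ψ (W.map (Int.castRingHom R)) hWR hT0 hTP
    hidX hidY hU' h₀ h₁ hsum hnZ hQM hα h2 hZx hZy hs0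
  -- `ξ(α(Ω₁ + u⁺)) − ξ(αΩ₁) = ξ(αu⁺) = ξ(u)` read in `M′`
  have hq' : ιc (j αR) * u' ∉ L.lattice := fun h => hu (by
    have h' := sub_mem h hαu
    rwa [sub_sub_cancel] at h')
  have eq_u : ιc (j αR) * u' = u + ((⟨ιc (j αR) * u' - u, hαu⟩ : L.lattice) : ℂ) := by
    change ιc (j αR) * u' = u + (ιc (j αR) * u' - u); ring
  have hxq : ιc xu = ℘[L] (ιc (j αR) * u') - (W.baseChange ℂ).b₂ / 12 := by rw [hxu, eq_u, L.weierstrassP_add_coe]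
  have hyq : ιc yu = (℘'[L] (ιc (j αR) * u') - (W.baseChange ℂ).a₁ * (℘[L] (ιc (j αR) * u') - (W.baseChange ℂ).b₂ / 12) -
      (W.baseChange ℂ).a₃) / 2 := by rw [hyu, eq_u, L.weierstrassP_add_coe, L.derivWeierstrassP_add_coe]
  have hXI : ((IntermediateField.inclusion hle XU : M') : AlgebraicClosure F) = ιv xu := hXU
  have hYI : ((IntermediateField.inclusion hle YU : M') : AlgebraicClosure F) = ιv yu := hYU
  have hnI := nonsingular_curveOver_of_readings e M' W ιc ιv L h₂ h₃ hq' hxq hyq hXI hYI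
  have hsub2 : (.some XZ YZ hnZ : (curveOver M' ((W.map (Int.castRingHom ℤ_[p])).map
      ((LTCoeff.of F).toRingHom.comp e.symm.toRingHom))).toAffine.Point) - .some _ _ h₁ = .some _ _ hnI :=
    some_sub_some_eq_some_curveOver_of_readings e M' W ιc ιv L h₂ h₃ hq' hαΩ₁ hαw (by ring) hxq hyq hx₁ hy₁ hxz hyz hXI hYI
      (hψj x₁) (hψj y₁) hXZ hYZ hnI h₁ hnZ
  rw [hsub2] at key
  have hI : (.some _ _ hnI : (curveOver M' ((W.map (Int.castRingHom ℤ_[p])).map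
      ((LTCoeff.of F).toRingHom.comp e.symm.toRingHom))).toAffine.Point) ∈ kernel (NormedField.valuation (K := M'))
      (curveOver M' ((W.map (Int.castRingHom ℤ_[p])).map ((LTCoeff.of F).toRingHom.comp e.symm.toRingHom))) :=
    some_inclusion_mem_kernel M hle _ (X := XU) (Y := YU) (h := hnU) hU
  rw [eq_zPt_of_ptOfZ_eq M' _ hI key]
  exact zPt_some_eq_inclPt_zPt_some M' _ hle hU hI rfl rfl

end Coherence

end Literature.NumberTheory.EllipticCurves

end
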